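import Summits.BirchSwinnertonDyer.BirchSwinnertonDyer.Theorems.KolyvaginRoadThreeSchneiderTamAtThreeHeightLogNumeratorExactPKappa
import HarnessLib

/-!
# «The height is the logarithm of the numerator» — part 10: THE TATE PARAMETER TO ARBITRARY PRECISION FROM `j`
# (finite rational certificates for `q_E`; generic complete ultrametric field)

HONEST FRAMING (cell `bsd-stepL`, seat `bsd-stepL-tam3-p2` g5, WIDTH-LEVER second lane «closed-form Schneider
local factor … by Kodaira type (finite case table proved once)»; `--supports stmt-BirchSwinnertonDyer-19154 --as helper`):
THEOREMS ONLY; 0 definitions, 0 named facts, 0 sorry; route-free; nothing about any particular curve; Schneider's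
conjecture and BSD asserted nowhere. WHY: every row checker of this chain (parts 6/6b/8c) and of g4's split digits reads
the Tate parameter `q_E` off `j(E)` through the `q`-expansion of `1/j` to FIXED order (`q ≡ 1/j`, `≡ 1/j + 744/j²`), which
caps the reachable precision at `2ν`, `3ν` digits (`ν = v_p(q_E) = v_p(Δ)`): the regimes `k ≤ ν` (non-split),
`k + v_L ≤ ν` (split); small-`ν` rows (type `I₁`, `I₂`: g4's 117 undecided rows at `3`, rest-p2's TR7/TR8 at `5`) are out of
reach of any fixed-order expansion. Here the order is a PARAMETER `M` and the approximation `q̃` a CERTIFICATE: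

* `norm_tateS_sub_sum_le` — `‖s_k(q) − Σ_{n<M} σ_k(n+1)qⁿ⁺¹‖ ≤ ‖q‖^{M+1}`; `norm_tateE4_sub_trunc_le` — the same for `E₄`;
* `norm_tateDelta_tail_factor_sub_one_le`, `multipliable_tateDelta_tail`, `norm_tprod_tateDelta_tail_sub_one_le`,
  `norm_tprod_tateDelta_factor_sub_prod_le` — `‖∏_{n≥1}(1 − qⁿ)²⁴ − ∏_{n≤M}(1 − qⁿ)²⁴‖ ≤ ‖q‖^{M+1}`;
* `norm_inv_tateJ_sub_truncJ_le` — **`‖1/j(q) − q·Π_M(q)/E_{4,M}(q)³‖ ≤ ‖q‖^{M+2}`** (`Π_M`, `E_{4,M}` the truncations);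
* `norm_sub_eq_norm_inv_tateJ_sub` — **`j ↦ 1/j` is an ISOMETRY of the punctured unit disc: `‖q − q'‖ = ‖1/j(q) − 1/j(q')‖`**
  (both directions of Silverman's contraction `norm_inv_tateJ_sub_sub_le`);
* `norm_tateParam_sub_le_of_cert` — **the certificate**: for THE parameter (`tateJ q = j₀`) and ANY `q̃` in the disc,
  `‖q − q̃‖ ≤ max(‖1/j₀ − q̃·Π_M(q̃)/E_{4,M}(q̃)³‖, ‖q̃‖^{M+2})` — a rational `q̃` (e.g. `M + 1` Newton digits) and ONE evaluation
  of two finite sums/products pin `q_E` to any prescribed number of digits, whatever `ν` is.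

References: [SilvermanATAEC1994] Thm. V.3.1 (b), Lemma V.5.1 (and its proof: `|f(q) − f(q′) − (q − q′)| < |q − q′|`);
tree: Literature `PAdicHeightsProofs` (`inv_tateJ_eq`, `norm_inv_tateJ_sub_sub_le`, `multipliable_tateDelta_factor`,
`norm_tateDelta_factor_eq_one`), `TateCurve/Invariants` (`summable_tateS_term`).
-/

noncomputable section

open scoped Classical
open scoped ArithmeticFunction.sigma
open Filter Topology IsUltrametricDist
open Literature.NumberTheory.EllipticCurves
open Literature.NumberTheory.EllipticCurves.SteinWuthrich2013
open Literature.NumberTheory.EllipticCurves.TateCurve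

namespace Summit.BirchSwinnertonDyer.Rank1Residual.X11b.RegMult.HeightLogNumerator

section TateApprox

variable {K : Type*} [NontriviallyNormedField K] [CompleteSpace K] [IsUltrametricDist K]

/-- **`‖s_k(q) − Σ_{n<M} σ_k(n+1)qⁿ⁺¹‖ ≤ ‖q‖^{M+1}`** for `‖q‖ < 1` (integer coefficients). [cite: SilvermanATAEC1994, Thm. V.3.1] -/
theorem norm_tateS_sub_sum_le (k M : ℕ) {q : K} (hq : ‖q‖ < 1) :
    ‖tateS k q - ∑ n ∈ Finset.range M, ((σ k (n + 1) : ℕ) : K) * q ^ (n + 1)‖ ≤ ‖q‖ ^ (M + 1) := by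
  have hsum := TateCurve.summable_tateS_term k hq
  have hsplit := hsum.sum_add_tsum_nat_add M
  have hdef : tateS k q = ∑' n : ℕ, ((σ k (n + 1) : ℕ) : K) * q ^ (n + 1) := by rw [tateS]
  rw [hdef, ← hsplit, add_sub_cancel_left]
  refine IsUltrametricDist.norm_tsum_le_of_forall_le_of_nonneg (by positivity) fun n ↦ ?_
  rw [norm_mul, norm_pow]
  calc ‖((σ k (n + M + 1) : ℕ) : K)‖ * ‖q‖ ^ (n + M + 1) ≤ 1 * ‖q‖ ^ (n + M + 1) := by
        gcongr; exact norm_natCast_le_one K _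
    _ = ‖q‖ ^ n * ‖q‖ ^ (M + 1) := by ring
    _ ≤ 1 * ‖q‖ ^ (M + 1) := by gcongr; exact pow_le_one₀ (norm_nonneg _) hq.le
    _ = ‖q‖ ^ (M + 1) := one_mul _

/-- **`‖E₄(q) − (1 + 240·Σ_{n<M} σ₃(n+1)qⁿ⁺¹)‖ ≤ ‖q‖^{M+1}`** for `‖q‖ < 1`. [cite: SilvermanATAEC1994, Thm. V.3.1] -/
theorem norm_tateE4_sub_trunc_le (M : ℕ) {q : K} (hq : ‖q‖ < 1) :
    ‖tateE4 q - (1 + 240 * ∑ n ∈ Finset.range M, ((σ 3 (n + 1) : ℕ) : K) * q ^ (n + 1))‖ ≤ ‖q‖ ^ (M + 1) := by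
  rw [tateE4_eq, show (1 : K) + 240 * tateS 3 q - (1 + 240 * ∑ n ∈ Finset.range M, ((σ 3 (n + 1) : ℕ) : K) * q ^ (n + 1)) =
    240 * (tateS 3 q - ∑ n ∈ Finset.range M, ((σ 3 (n + 1) : ℕ) : K) * q ^ (n + 1)) by ring, norm_mul]
  calc ‖(240 : K)‖ * _ ≤ 1 * ‖q‖ ^ (M + 1) := by
        refine mul_le_mul ?_ (norm_tateS_sub_sum_le 3 M hq) (norm_nonneg _) zero_le_one
        exact_mod_cast norm_natCast_le_one K 240
    _ = ‖q‖ ^ (M + 1) := one_mul _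

omit [CompleteSpace K] in
/-- Each tail factor satisfies `‖(1 − q^{i+M+1})²⁴ − 1‖ ≤ ‖q‖^{M+1}·‖q‖ⁱ` (`‖q‖ ≤ 1`). [folklore] -/
theorem norm_tateDelta_tail_factor_sub_one_le (M i : ℕ) {q : K} (hq : ‖q‖ ≤ 1) :
    ‖(1 - q ^ (i + M + 1)) ^ 24 - 1‖ ≤ ‖q‖ ^ (M + 1) * ‖q‖ ^ i := by
  have h1 : ‖1 - q ^ (i + M + 1)‖ ≤ 1 := by
    rw [sub_eq_add_neg]
    refine (norm_add_le_max _ _).trans (max_le (by rw [norm_one]) ?_)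
    rw [norm_neg, norm_pow]; exact pow_le_one₀ (norm_nonneg _) hq
  calc ‖(1 - q ^ (i + M + 1)) ^ 24 - 1‖ = ‖(1 - q ^ (i + M + 1)) ^ 24 - 1 ^ 24‖ := by rw [one_pow]
    _ ≤ ‖(1 - q ^ (i + M + 1)) - 1‖ := norm_pow_sub_pow_le h1 (by rw [norm_one]) 24
    _ = ‖q‖ ^ (M + 1) * ‖q‖ ^ i := by
        rw [sub_sub_cancel_left, norm_neg, norm_pow, ← pow_add]; ring

/-- The tail `∏_{i} (1 − q^{i+M+1})²⁴` is multipliable for `‖q‖ < 1`. [folklore] -/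
theorem multipliable_tateDelta_tail (M : ℕ) {q : K} (hq : ‖q‖ < 1) :
    Multipliable fun i : ℕ ↦ (1 - q ^ (i + M + 1)) ^ 24 := by
  have heq : (fun i : ℕ ↦ (1 - q ^ (i + M + 1)) ^ 24) =
      fun i : ℕ ↦ 1 + ((1 - q ^ (i + M + 1)) ^ 24 - 1) := by
    funext i; ring
  rw [heq]
  refine multipliable_one_add_of_summable ?_
  exact Summable.of_nonneg_of_le (fun _ ↦ norm_nonneg _)
    (fun i ↦ norm_tateDelta_tail_factor_sub_one_le M i hq.le)
    ((summable_geometric_of_lt_one (norm_nonneg q) hq).mul_left (‖q‖ ^ (M + 1)))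

/-- The tail product `∏_{i} (1 − q^{i+M+1})²⁴` is within `‖q‖^{M+1}` of `1` (`‖q‖ < 1`). [folklore] -/
theorem norm_tprod_tateDelta_tail_sub_one_le (M : ℕ) {q : K} (hq : ‖q‖ < 1) :
    ‖(∏' i : ℕ, (1 - q ^ (i + M + 1)) ^ 24) - 1‖ ≤ ‖q‖ ^ (M + 1) := by
  have hP0 := (multipliable_tateDelta_tail M hq).hasProd
  have h1 : Tendsto (fun s : Finset ℕ ↦ ∏ _i ∈ s, (1 : K)) atTop (𝓝 1) := by
    simp only [Finset.prod_const_one]; exact tendsto_const_nhds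
  have hP := (hP0.sub h1).norm
  refine le_of_tendsto' hP fun s ↦ ?_
  refine norm_prod_sub_prod_le (pow_nonneg (norm_nonneg q) (M + 1))
    (fun i ↦ (norm_tateDelta_factor_eq_one hq (i + M)).le) (fun _ ↦ by rw [norm_one]) (fun i ↦ ?_) s
  exact (norm_tateDelta_tail_factor_sub_one_le M i hq.le).trans
    (mul_le_of_le_one_right (pow_nonneg (norm_nonneg _) _) (pow_le_one₀ (norm_nonneg _) hq.le))

/-- **`‖∏_{n≥1}(1 − qⁿ)²⁴ − ∏_{n=1}^{M}(1 − qⁿ)²⁴‖ ≤ ‖q‖^{M+1}`** for `‖q‖ < 1`: the tail `∏_{n>M}` is within `‖q‖^{M+1}` of `1`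
and the head has norm `1`. [cite: SilvermanATAEC1994, Thm. V.3.1] -/
theorem norm_tprod_tateDelta_factor_sub_prod_le (M : ℕ) {q : K} (hq : ‖q‖ < 1) :
    ‖(∏' n : ℕ, (1 - q ^ (n + 1)) ^ 24) - ∏ n ∈ Finset.range M, (1 - q ^ (n + 1)) ^ 24‖ ≤ ‖q‖ ^ (M + 1) := by
  have hsplit : (∏ n ∈ Finset.range M, (1 - q ^ (n + 1)) ^ 24) * (∏' i : ℕ, (1 - q ^ (i + M + 1)) ^ 24) =
      ∏' n : ℕ, (1 - q ^ (n + 1)) ^ 24 :=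
    Multipliable.prod_mul_tprod_nat_mul' (f := fun n : ℕ ↦ (1 - q ^ (n + 1)) ^ 24) (k := M)
      (multipliable_tateDelta_tail M hq)
  have hHn : ‖∏ n ∈ Finset.range M, (1 - q ^ (n + 1)) ^ 24‖ = 1 := by
    rw [norm_prod]; exact Finset.prod_eq_one fun n _ ↦ norm_tateDelta_factor_eq_one hq n
  have e : (∏' n : ℕ, (1 - q ^ (n + 1)) ^ 24) - ∏ n ∈ Finset.range M, (1 - q ^ (n + 1)) ^ 24 =
      (∏ n ∈ Finset.range M, (1 - q ^ (n + 1)) ^ 24) * ((∏' i : ℕ, (1 - q ^ (i + M + 1)) ^ 24) - 1) := by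
    rw [← hsplit, mul_sub, mul_one]
  rw [e, norm_mul, hHn, one_mul]
  exact norm_tprod_tateDelta_tail_sub_one_le M hq

/-- **`1/j(q)` by its truncated `q`-expansion data: `‖1/j(q) − q·Π_M(q)/E_{4,M}(q)³‖ ≤ ‖q‖^{M+2}`** for `‖q‖ < 1`, with
`Π_M = ∏_{n=1}^{M}(1 − qⁿ)²⁴`, `E_{4,M} = 1 + 240Σ_{n=1}^{M}σ₃(n)qⁿ` (`1/j = qΠ/E₄³`, the tree's `inv_tateJ_eq`; both truncation
errors are `≤ ‖q‖^{M+1}` and all four quantities are units). [cite: SilvermanATAEC1994, Thm. V.3.1 (b)] -/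
theorem norm_inv_tateJ_sub_truncJ_le (M : ℕ) {q : K} (hq : ‖q‖ < 1) :
    ‖(tateJ q)⁻¹ - q * (∏ n ∈ Finset.range M, (1 - q ^ (n + 1)) ^ 24) /
        (1 + 240 * ∑ n ∈ Finset.range M, ((σ 3 (n + 1) : ℕ) : K) * q ^ (n + 1)) ^ 3‖ ≤ ‖q‖ ^ (M + 2) := by
  set P : K := ∏' n : ℕ, (1 - q ^ (n + 1)) ^ 24 with hP
  set H : K := ∏ n ∈ Finset.range M, (1 - q ^ (n + 1)) ^ 24 with hH
  set E : K := tateE4 q with hE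
  set EM : K := 1 + 240 * ∑ n ∈ Finset.range M, ((σ 3 (n + 1) : ℕ) : K) * q ^ (n + 1) with hEM
  have hPn : ‖P‖ = 1 := norm_tprod_tateDelta_factor_eq_one hq
  have hHn : ‖H‖ = 1 := by
    rw [hH, norm_prod]; exact Finset.prod_eq_one fun n _ ↦ norm_tateDelta_factor_eq_one hq n
  have hEn : ‖E‖ = 1 := norm_tateE4_eq_one hq
  have hPH : ‖P - H‖ ≤ ‖q‖ ^ (M + 1) := norm_tprod_tateDelta_factor_sub_prod_le M hq
  have hEEM : ‖E - EM‖ ≤ ‖q‖ ^ (M + 1) := norm_tateE4_sub_trunc_le M hq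
  have hEMn : ‖EM‖ = 1 := by
    have hlt : ‖E - EM‖ < ‖E‖ := by
      rw [hEn]; exact hEEM.trans_lt (pow_lt_one₀ (norm_nonneg _) hq (by omega))
    rw [← hEn, show EM = E + -(E - EM) by ring, norm_add_eq_max_of_norm_ne_norm (by rw [norm_neg]; exact hlt.ne'),
      norm_neg, max_eq_left hlt.le]
  have hE0 : E ≠ 0 := norm_pos_iff.mp (by rw [hEn]; exact one_pos)
  have hEM0 : EM ≠ 0 := norm_pos_iff.mp (by rw [hEMn]; exact one_pos)
  have hinv : (tateJ q)⁻¹ = q * P / E ^ 3 := by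
    rw [inv_tateJ_eq hq, ← hP, ← hE]; field_simp; ring
  have e : (tateJ q)⁻¹ - q * H / EM ^ 3 = q * ((P - H) * EM ^ 3 + H * (EM ^ 3 - E ^ 3)) / (E ^ 3 * EM ^ 3) := by
    rw [hinv]; field_simp; ring
  rw [e, norm_div, norm_mul, norm_mul, norm_pow, norm_pow, hEn, hEMn, one_pow, mul_one, div_one]
  have h3 : ‖EM ^ 3 - E ^ 3‖ ≤ ‖q‖ ^ (M + 1) := by
    refine (norm_pow_sub_pow_le hEMn.le hEn.le 3).trans ?_
    rw [norm_sub_rev]; exact hEEM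
  calc ‖q‖ * ‖(P - H) * EM ^ 3 + H * (EM ^ 3 - E ^ 3)‖ ≤ ‖q‖ * ‖q‖ ^ (M + 1) := by
        gcongr
        refine (norm_add_le_max _ _).trans (max_le ?_ ?_)
        · rw [norm_mul, norm_pow, hEMn, one_pow, mul_one]; exact hPH
        · rw [norm_mul, hHn, one_mul]; exact h3
    _ = ‖q‖ ^ (M + 2) := by ring

/-- **`q ↦ 1/j(q)` is an isometry of the punctured open unit disc: `‖q − q'‖ = ‖1/j(q) − 1/j(q')‖`** (Silverman's
contraction `‖(1/j(q) − q) − (1/j(q′) − q′)‖ ≤ max(‖q‖,‖q′‖)·‖q − q′‖ < ‖q − q'‖`, tree `norm_inv_tateJ_sub_sub_le`).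
[cite: SilvermanATAEC1994, Lemma V.5.1] -/
theorem norm_sub_eq_norm_inv_tateJ_sub {q q' : K} (hq : ‖q‖ < 1) (hq' : ‖q'‖ < 1) :
    ‖q - q'‖ = ‖(tateJ q)⁻¹ - (tateJ q')⁻¹‖ := by
  rcases eq_or_ne q q' with h | h
  · subst h; simp
  · have hpos : 0 < ‖q - q'‖ := norm_pos_iff.mpr (sub_ne_zero.mpr h)
    have hc := norm_inv_tateJ_sub_sub_le hq hq'
    have hlt : ‖((tateJ q)⁻¹ - q) - ((tateJ q')⁻¹ - q')‖ < ‖q - q'‖ := by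
      refine hc.trans_lt ?_
      calc max ‖q‖ ‖q'‖ * ‖q - q'‖ < 1 * ‖q - q'‖ := mul_lt_mul_of_pos_right (max_lt hq hq') hpos
        _ = ‖q - q'‖ := one_mul _
    rw [show (tateJ q)⁻¹ - (tateJ q')⁻¹ = (q - q') + (((tateJ q)⁻¹ - q) - ((tateJ q')⁻¹ - q')) by ring,
      norm_add_eq_max_of_norm_ne_norm hlt.ne', max_eq_left hlt.le]

/-- **THE TATE PARAMETER TO ARBITRARY PRECISION (certificate form).** For THE parameter `q` of `j₀` (`‖q‖ < 1`,
`tateJ q = j₀`) and ANY `q̃` with `‖q̃‖ < 1`: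
**`‖q − q̃‖ ≤ max(‖j₀⁻¹ − q̃·Π_M(q̃)/E_{4,M}(q̃)³‖, ‖q̃‖^{M+2})`** — the first term is a finite rational computation when `j₀`
and `q̃` are rational, the second is as small as one likes. [cite: SilvermanATAEC1994, Thm. V.3.1 (b), Lemma V.5.1] -/
theorem norm_tateParam_sub_le_of_cert (M : ℕ) {q q' j₀ : K} (hq : ‖q‖ < 1) (hj : tateJ q = j₀) (hq' : ‖q'‖ < 1) :
    ‖q - q'‖ ≤ max ‖j₀⁻¹ - q' * (∏ n ∈ Finset.range M, (1 - q' ^ (n + 1)) ^ 24) /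
        (1 + 240 * ∑ n ∈ Finset.range M, ((σ 3 (n + 1) : ℕ) : K) * q' ^ (n + 1)) ^ 3‖ (‖q'‖ ^ (M + 2)) := by
  rw [norm_sub_eq_norm_inv_tateJ_sub hq hq', hj,
    show j₀⁻¹ - (tateJ q')⁻¹ = (j₀⁻¹ - q' * (∏ n ∈ Finset.range M, (1 - q' ^ (n + 1)) ^ 24) /
        (1 + 240 * ∑ n ∈ Finset.range M, ((σ 3 (n + 1) : ℕ) : K) * q' ^ (n + 1)) ^ 3) +
      -((tateJ q')⁻¹ - q' * (∏ n ∈ Finset.range M, (1 - q' ^ (n + 1)) ^ 24) /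
        (1 + 240 * ∑ n ∈ Finset.range M, ((σ 3 (n + 1) : ℕ) : K) * q' ^ (n + 1)) ^ 3) by ring]
  refine (norm_add_le_max _ _).trans (max_le_max le_rfl ?_)
  rw [norm_neg]; exact norm_inv_tateJ_sub_truncJ_le M hq'

end TateApprox

end Summit.BirchSwinnertonDyer.Rank1Residual.X11b.RegMult.HeightLogNumerator

end
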